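import Summits.Schanuel.Schanuel.Theorems.RootDecomp1KRadical04

/-!
# RootDecomp1KRadical («RADICAL CELLS», lens 6 gen 11) — continuation (RootDecomp1KRadical05): §24 INSTANCE FIX: the fixed points of exp (e^t = t) have finite transcendence type mod the registered fact NW96 Thm 1 (binder hNW): fix_approx, fix_measure, finiteTranscendenceType_fixpoint

Part of the six-file split (400-line rule) of lens 6's gen-11 node «RADICAL CELLS» = HOME/decomp-schanuel-lens-6/g11/addendum/RadicalCells.lean (sha256 16cddffc…, 2182 l;
1K ROUND 8 THEOREM ROUND, PATH T; critic VERDICT 2026-08-30T18:23:36Z ACCEPTED; census C-7bis; `--supports stmt-Schanuel-33363`). Port hygiene: the node's COPY blocks of §19/§21/§22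
declarations are NOT re-declared — they are the landed ones of Theorems/RootDecomp1KDark*/Torsion*/Kummer* (opened by name); twins of private/foreign tree lemmas are private here.
All parts share the namespace `Summit.Schanuel.Schanuel.Theorems.RootDecomp1KRadical`; the node docstring is in part 01. Sorry-free; standard axioms. Nothing here proves Schanuel; rung 0.
-/

noncomputable section

open Complex IntermediateField Polynomial

namespace Summit.Schanuel.Schanuel.Theorems.RootDecomp1KRadical

open Summit.Schanuel.Schanuel.Theorems.RootDecomp1KHyper (len len_nonneg one_le_len abs_coeff_le_len)
open Summit.Schanuel.Schanuel.Theorems.RootDecomp1KHyper.HyperCell (norm_aeval_le_len_mul_pow conjFactor sliceAt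
  relHat resPoly eval_conjFactor eval_sliceAt natDegree_conjFactor_le coeff_conjFactor natDegree_sliceAt_le
  natDegree_relHat_le evC evC_apply evC_comp_C map_relHat_evC relLen relLen_nonneg eval_map_int
  isAlgebraic_of_aeval_int norm_multiset_map_prod_le multiset_map_prod_le torCo torG aeval_torG natDegree_torG_le
  coeff_torG torCo_cast_eq eval_conjFactor_torG torD coeff_torD torD_ne_zero coeff_torG_eq_torD denBound
  den_lt_denBound norm_mvaeval_le cP cP_nonneg one_le_cP abs_torCo_le abs_coeff_torG_le len_torG_le relLen_torG_le
  pow_le_exp_mul eta_lt_delta upper_exp algebraicIndependent_of_forall_int HyperLiouville.rat_mul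
  dvd_of_irreducible_of_common_root pair_bounds HyperLiouville.ne_ratCast HyperLiouville.ne_zero HyperLiouville.neg)

variable {K : ℕ}

open Summit.Schanuel.Schanuel.Theorems.RootDecomp1KHyper.HyperCell (HyperLiouville)
open Summit.Schanuel.Schanuel.Theorems.RootDecomp1KHyper (WMeasure SB SFset sb_of_algebraicIndependent
  mem_adjoin_SFset_I')

/-- `Real.log x ≤ x`. -/
private theorem log_le_self_of_pos {x : ℝ} (hx : 0 < x) : Real.log x ≤ x := by
  linarith [Real.log_le_sub_one_of_pos hx]

/-! ## 24. INSTANCE FIX: the fixed points of `exp` (`e^t = t`) have finite transcendence type (mod NW96 Thm 1)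

`t` with `e^t = t` (infinitely many, all transcendental, `(t, e^t)` algebraically DEPENDENT — the darkest
exponential-algebraic points): NW 1996 Theorem 1 at `θ = t`, `α = β = ξ` reads `2|t − ξ| ≥ exp(−…)`, an
approximation measure for `t`; Fel'dman's transference (tree, `transcendenceMeasure_of_approximationMeasure`)
turns it into a transcendence measure, polynomial in `(deg, log H)`. -/

section Fix
open Literature.NumberTheory.Transcendental

/-- The Mahler measure of a non-zero integer polynomial (mapped to `ℂ`) is at least `1` (private copy of the landed wave lemma). -/
private theorem one_le_mahlerMeasure_map_of_ne_zero {R : ℤ[X]} (hR : R ≠ 0) :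
    1 ≤ (R.map (Int.castRingHom ℂ)).mahlerMeasure := by
  refine one_le_mahlerMeasure_of_one_le_norm_leadingCoeff ?_
  rw [Polynomial.leadingCoeff_map_of_injective (RingHom.injective_int _), eq_intCast,
    Complex.norm_intCast]
  exact_mod_cast Int.one_le_abs (Polynomial.leadingCoeff_ne_zero.mpr hR)

/-- Mahler measure is monotone under divisibility of non-zero integer polynomials (private copy of the landed wave lemma). -/
private theorem mahlerMeasure_le_of_dvd {Q A : ℤ[X]} (hdvd : Q ∣ A) (hA : A ≠ 0) :
    (Q.map (Int.castRingHom ℂ)).mahlerMeasure ≤ (A.map (Int.castRingHom ℂ)).mahlerMeasure := by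
  obtain ⟨R, rfl⟩ := hdvd
  have hR : R ≠ 0 := right_ne_zero_of_mul hA
  rw [Polynomial.map_mul, mahlerMeasure_mul]
  calc (Q.map (Int.castRingHom ℂ)).mahlerMeasure = (Q.map (Int.castRingHom ℂ)).mahlerMeasure * 1 :=
        (mul_one _).symm
    _ ≤ _ := mul_le_mul_of_nonneg_left (one_le_mahlerMeasure_map_of_ne_zero hR)
        (mahlerMeasure_nonneg _)

/-! #### the fixed points -/

/-- `2 * Real.exp 1 < 6`. -/
private theorem two_e_lt_six : 2 * Real.exp 1 < 6 := by
  have := Real.exp_one_lt_d9; linarith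

/-- a fixed point of `exp` has modulus `≥ 1/2` (and is `≠ 0`) -/
theorem half_le_norm_of_exp_eq_self {t : ℂ} (ht : cexp t = t) : 1 / 2 ≤ ‖t‖ := by
  by_contra h
  push Not at h
  have h1 : ‖t‖ = Real.exp t.re := by have := Complex.norm_exp t; rwa [ht] at this
  have h2 : -‖t‖ ≤ t.re := by
    have := Complex.abs_re_le_norm t
    have := neg_abs_le t.re
    linarith
  have h3 : Real.exp (-(1 / 2 : ℝ)) ≤ Real.exp t.re := Real.exp_le_exp.mpr (by linarith)
  have h4 : (1 : ℝ) / 2 ≤ Real.exp (-(1 / 2 : ℝ)) := by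
    have := Real.add_one_le_exp (-(1 / 2 : ℝ)); linarith
  linarith

/-- `t ≠ 0`. -/
theorem ne_zero_of_exp_eq_self {t : ℂ} (ht : cexp t = t) : t ≠ 0 := by
  intro h0
  have := half_le_norm_of_exp_eq_self ht
  rw [h0, norm_zero] at this
  linarith

/-- the (crude, polynomial) approximation exponent `φ_T(d, L)` for a fixed point of modulus `T` -/
def fphi (T : ℝ) (d L : ℕ) : ℝ :=
  211 * d * (2 * Real.log L + 4 * (d : ℝ) ^ 2 + 2 * T + 12) *
    ((d : ℝ) ^ 2 * (1 + Real.log L) + 6 * T + 6) * (33 / 10 * (d : ℝ) ^ 2 * ((d : ℝ) ^ 2 + 1) + 1) + 1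

/-- `0 ≤ fphi T d L`. -/
theorem fphi_nonneg {T : ℝ} (hT : 0 ≤ T) (d L : ℕ) : 0 ≤ fphi T d L := by
  unfold fphi
  have : 0 ≤ Real.log L := Real.log_natCast_nonneg L
  positivity

/-- `1 ≤ fphi T d L`. -/
theorem one_le_fphi {T : ℝ} (hT : 0 ≤ T) (d L : ℕ) : 1 ≤ fphi T d L := by
  unfold fphi
  have : 0 ≤ Real.log L := Real.log_natCast_nonneg L
  have h0 : 0 ≤ 211 * (d : ℝ) * (2 * Real.log L + 4 * (d : ℝ) ^ 2 + 2 * T + 12) *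
      ((d : ℝ) ^ 2 * (1 + Real.log L) + 6 * T + 6) * (33 / 10 * (d : ℝ) ^ 2 * ((d : ℝ) ^ 2 + 1) + 1) := by
    positivity
  linarith

/-- `fphi T n L ≤ fphi T d L`. -/
theorem fphi_mono {T : ℝ} (hT : 0 ≤ T) {n d : ℕ} (L : ℕ) (h : n ≤ d) : fphi T n L ≤ fphi T d L := by
  unfold fphi
  have hL : 0 ≤ Real.log L := Real.log_natCast_nonneg L
  have h' : (n : ℝ) ≤ d := by exact_mod_cast h
  have hn0 : (0 : ℝ) ≤ n := Nat.cast_nonneg n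
  gcongr

set_option maxHeartbeats 1600000 in
/-- **Approximation measure at a fixed point of `exp` (mod NW 1996 Thm 1).** -/
theorem fix_approx (hNW : NesterenkoWaldschmidt1996_thm_1) {t : ℂ} (ht : cexp t = t) (Q : ℤ[X]) (ξ : ℂ)
    (L : ℕ) (hQ : Irreducible Q) (hn : 0 < Q.natDegree) (hξ : aeval ξ Q = 0)
    (hlen : (∑ k ∈ Finset.range (Q.natDegree + 1), |Q.coeff k|) ≤ (L : ℤ)) (hL : 3 ≤ L) :
    Real.exp (-(Q.natDegree * fphi ‖t‖ Q.natDegree L)) ≤ ‖t - ξ‖ := by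
  have ht0 : t ≠ 0 := ne_zero_of_exp_eq_self ht
  have htn : 1 / 2 ≤ ‖t‖ := half_le_norm_of_exp_eq_self ht
  have hT0 : 0 ≤ ‖t‖ := norm_nonneg t
  set d : ℕ := Q.natDegree with hd
  have hd1 : (1 : ℝ) ≤ d := by exact_mod_cast hn
  have hd0 : (0 : ℝ) < d := by linarith
  have hL3 : (3 : ℝ) ≤ L := by exact_mod_cast hL
  have hL0 : (0 : ℝ) < L := by linarith
  have hlogL : 0 ≤ Real.log L := Real.log_natCast_nonneg L
  have hlogL1 : 1 ≤ Real.log L := by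
    rw [← Real.log_exp 1]
    exact Real.log_le_log (Real.exp_pos 1) (by have := Real.exp_one_lt_d9; linarith)
  -- the exponent is large: `d φ ≥ 1`
  have hbig : 1 ≤ (d : ℝ) * fphi ‖t‖ d L := by
    have := one_le_fphi hT0 d L
    nlinarith
  have hhalf : Real.exp (-1) ≤ 1 / 2 := by have := Real.exp_neg_one_lt_d9; linarith
  by_cases hξ0 : ξ = 0
  · rw [hξ0, sub_zero]
    calc Real.exp (-(d * fphi ‖t‖ d L)) ≤ Real.exp (-1) := Real.exp_le_exp.mpr (by linarith)
      _ ≤ 1 / 2 := hhalf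
      _ ≤ ‖t‖ := htn
  -- Theorem 1 at `θ = t`, `α = β = ξ`, `A = e·L`, `B = L`, `E = e`
  obtain ⟨hαalg, -, hD1, hDle, hhα, -⟩ := pair_bounds Q hQ hn hξ Q hQ.ne_zero hξ
  set D : ℕ := Module.finrank ℚ (IntermediateField.adjoin ℚ ({ξ, ξ} : Set ℂ)) with hDdef
  have hMQ1 : 1 ≤ (Q.map (Int.castRingHom ℂ)).mahlerMeasure :=
    one_le_mahlerMeasure_map_of_ne_zero hQ.ne_zero
  have hMQL : (Q.map (Int.castRingHom ℂ)).mahlerMeasure ≤ L := by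
    refine (NesterenkoWaldschmidt1996.mahlerMeasure_le_length Q).trans ?_
    exact_mod_cast hlen
  have hh : weilHeight₁ (IntermediateField.adjoin ℚ ({ξ, ξ} : Set ℂ)) (fun _ : Unit => ξ) ≤
      Real.log L := hhα.trans (Real.log_le_log (by linarith) hMQL)
  have hlogA : Real.log (Real.exp 1 * L) = 1 + Real.log L := by
    rw [Real.log_mul (Real.exp_pos 1).ne' hL0.ne', Real.log_exp]
  have hDr1 : (1 : ℝ) ≤ D := by exact_mod_cast hD1
  have hDr0 : (0 : ℝ) < D := by linarith
  have hA : max (weilHeight₁ (IntermediateField.adjoin ℚ ({ξ, ξ} : Set ℂ)) (fun _ : Unit => ξ))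
      (1 / (D : ℝ)) ≤ Real.log (Real.exp 1 * L) := by
    rw [hlogA]
    refine max_le (hh.trans (by linarith)) ?_
    rw [div_le_iff₀ hDr0]
    nlinarith
  have hmain := hNW t ξ ξ (Real.exp 1 * L) L (Real.exp 1) ht0 hξ0 hξ0 hαalg hαalg
    (by positivity) hL0 le_rfl hA hh
  rw [ht, ← hDdef, Real.log_exp, hlogA, one_pow, div_one] at hmain
  -- `2 |t − ξ| ≥ exp(−X)` ⇒ `|t − ξ| ≥ exp(−X − 1)`
  have htwo : ‖t - ξ‖ + ‖t - ξ‖ = 2 * ‖t - ξ‖ := by ring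
  rw [htwo] at hmain
  have key : ∀ X : ℝ, Real.exp (-X) ≤ 2 * ‖t - ξ‖ → X + 1 ≤ d * fphi ‖t‖ d L →
      Real.exp (-(d * fphi ‖t‖ d L)) ≤ ‖t - ξ‖ := by
    intro X h1 h2
    have h3 : Real.exp (-(d * fphi ‖t‖ d L)) ≤ Real.exp (-X) * Real.exp (-1) := by
      rw [← Real.exp_add]; exact Real.exp_le_exp.mpr (by linarith)
    have h4 : Real.exp (-X) * Real.exp (-1) ≤ 2 * ‖t - ξ‖ * (1 / 2) :=
      mul_le_mul h1 hhalf (Real.exp_pos _).le (by positivity)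
    linarith
  refine key _ hmain ?_
  -- the three factors
  have hDd : (D : ℝ) ≤ (d : ℝ) ^ 2 := by
    have : (D : ℝ) ≤ (d : ℝ) * d := by exact_mod_cast hDle
    nlinarith
  have hlogD : Real.log D ≤ (d : ℝ) ^ 2 := by
    have := Real.log_le_sub_one_of_pos hDr0; linarith
  have hlogD0 : 0 ≤ Real.log D := Real.log_nonneg hDr1
  have hlogD2 : Real.log ((D : ℝ) + 2) ≤ (d : ℝ) ^ 2 + 1 := by
    have := Real.log_le_sub_one_of_pos (by linarith : (0 : ℝ) < D + 2); linarith
  have hlogD20 : 0 ≤ Real.log ((D : ℝ) + 2) := Real.log_nonneg (by linarith)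
  have hll : Real.log (1 + Real.log L) ≤ Real.log L := by
    have := Real.log_le_sub_one_of_pos (by linarith : (0 : ℝ) < 1 + Real.log L); linarith
  have hmax1 : 1 ≤ max 1 ‖t‖ := le_max_left _ _
  have hmaxT : max 1 ‖t‖ ≤ 1 + ‖t‖ := max_le (by linarith) (by linarith)
  have hlogE : Real.log (Real.exp 1 * max 1 ‖t‖) ≤ 1 + ‖t‖ := by
    rw [Real.log_mul (Real.exp_pos 1).ne' (by linarith), Real.log_exp]
    have := Real.log_le_sub_one_of_pos (by linarith : (0 : ℝ) < max 1 ‖t‖)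
    linarith
  have f1 : Real.log L + Real.log (1 + Real.log L) + 4 * Real.log D +
      2 * Real.log (Real.exp 1 * max 1 ‖t‖) + 10 ≤ 2 * Real.log L + 4 * (d : ℝ) ^ 2 + 2 * ‖t‖ + 12 := by
    linarith
  have f1pos : 0 ≤ Real.log L + Real.log (1 + Real.log L) + 4 * Real.log D +
      2 * Real.log (Real.exp 1 * max 1 ‖t‖) + 10 := by
    have : 0 ≤ Real.log (1 + Real.log L) := Real.log_nonneg (by linarith)
    have : 0 ≤ Real.log (Real.exp 1 * max 1 ‖t‖) := Real.log_nonneg (by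
      have := Real.add_one_le_exp (1 : ℝ); nlinarith)
    positivity
  have f2 : (D : ℝ) * (1 + Real.log L) + 2 * Real.exp 1 * ‖t‖ + 6 * 1 ≤
      (d : ℝ) ^ 2 * (1 + Real.log L) + 6 * ‖t‖ + 6 := by
    have a := mul_le_mul_of_nonneg_right hDd (by linarith : (0 : ℝ) ≤ 1 + Real.log L)
    have b : 2 * Real.exp 1 * ‖t‖ ≤ 6 * ‖t‖ := mul_le_mul_of_nonneg_right two_e_lt_six.le hT0
    linarith
  have f2pos : 0 ≤ (D : ℝ) * (1 + Real.log L) + 2 * Real.exp 1 * ‖t‖ + 6 * 1 := by positivity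
  have f3 : 33 / 10 * (D : ℝ) * Real.log ((D : ℝ) + 2) + 1 ≤
      33 / 10 * (d : ℝ) ^ 2 * ((d : ℝ) ^ 2 + 1) + 1 := by
    have := mul_le_mul hDd hlogD2 hlogD20 (by positivity)
    nlinarith
  have f3pos : 0 ≤ 33 / 10 * (D : ℝ) * Real.log ((D : ℝ) + 2) + 1 := by positivity
  unfold fphi
  have hprod : 211 * (D : ℝ) * (Real.log L + Real.log (1 + Real.log L) + 4 * Real.log D +
        2 * Real.log (Real.exp 1 * max 1 ‖t‖) + 10) *
        ((D : ℝ) * (1 + Real.log L) + 2 * Real.exp 1 * ‖t‖ + 6 * 1) *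
        (33 / 10 * (D : ℝ) * Real.log ((D : ℝ) + 2) + 1) ≤
      211 * (d : ℝ) ^ 2 * (2 * Real.log L + 4 * (d : ℝ) ^ 2 + 2 * ‖t‖ + 12) *
        ((d : ℝ) ^ 2 * (1 + Real.log L) + 6 * ‖t‖ + 6) *
        (33 / 10 * (d : ℝ) ^ 2 * ((d : ℝ) ^ 2 + 1) + 1) := by
    gcongr
  have e : (d : ℝ) * (211 * d * (2 * Real.log L + 4 * (d : ℝ) ^ 2 + 2 * ‖t‖ + 12) *
        ((d : ℝ) ^ 2 * (1 + Real.log L) + 6 * ‖t‖ + 6) *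
        (33 / 10 * (d : ℝ) ^ 2 * ((d : ℝ) ^ 2 + 1) + 1) + 1) =
      211 * (d : ℝ) ^ 2 * (2 * Real.log L + 4 * (d : ℝ) ^ 2 + 2 * ‖t‖ + 12) *
        ((d : ℝ) ^ 2 * (1 + Real.log L) + 6 * ‖t‖ + 6) *
        (33 / 10 * (d : ℝ) ^ 2 * ((d : ℝ) ^ 2 + 1) + 1) + d := by ring
  linarith [hprod, e, hd1]

/-- **Transcendence measure at a fixed point of `exp` (mod NW 1996 Thm 1)**, via Fel'dman's transference (tree). -/
theorem fix_measure (hNW : NesterenkoWaldschmidt1996_thm_1) {t : ℂ} (ht : cexp t = t) (S : ℤ[X])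
    (hS : S ≠ 0) {d : ℕ} (hd : 1 ≤ d) (hdeg : S.natDegree ≤ d) {L : ℕ}
    (hlen : (∑ k ∈ Finset.range (S.natDegree + 1), |S.coeff k|) ≤ (L : ℤ)) (hL : 3 ≤ L) :
    Real.exp (-(d * (fphi ‖t‖ d (2 ^ d * L) + Real.log (2 * d * L)))) ≤ ‖aeval t S‖ := by
  have h := NesterenkoWaldschmidt1996.transcendenceMeasure_of_approximationMeasure t (fphi ‖t‖)
    (fun n L => fphi_nonneg (norm_nonneg t) n L) (fun n d L h => fphi_mono (norm_nonneg t) L h)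
    (fun Q ξ L hQ hn hξ hlen hL => fix_approx hNW ht Q ξ L hQ hn hξ hlen hL) S hS d L hd hdeg hlen hL
  exact_mod_cast h

/-- the fixed-point exponent is `≤ c_T (N + log H)^{11}`. -/
theorem fix_exponent_le {T N X LgL Lg2 : ℝ} (hT : 0 ≤ T) (hX1 : 1 ≤ X) (hN0 : 0 ≤ N) (hNX : N ≤ X)
    (hLgL0 : 0 ≤ LgL) (hLgL : LgL ≤ 2 * X) (hLg20 : 0 ≤ Lg2) (hLg2 : Lg2 ≤ 3 * X) :
    N * ((211 * N * (2 * LgL + 4 * N ^ 2 + 2 * T + 12) * (N ^ 2 * (1 + LgL) + 6 * T + 6) *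
        (33 / 10 * N ^ 2 * (N ^ 2 + 1) + 1) + 1) + Lg2) ≤
      (1688 * (20 + 2 * T) * (6 * T + 9) + 4) * X ^ 11 := by
  have hX0 : 0 ≤ X := by linarith
  have hX2 : X ≤ X ^ 2 := by nlinarith
  have hX21 : 1 ≤ X ^ 2 := by nlinarith
  have hN2 : N ^ 2 ≤ X ^ 2 := pow_le_pow_left₀ hN0 hNX 2
  have hX3 : (1 : ℝ) ≤ X ^ 3 := one_le_pow₀ hX1
  have hX4 : (1 : ℝ) ≤ X ^ 4 := one_le_pow₀ hX1
  have hX10 : (1 : ℝ) ≤ X ^ 10 := one_le_pow₀ hX1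
  have hXX10 : X ≤ X ^ 10 := by
    calc X = X ^ 1 := (pow_one X).symm
      _ ≤ X ^ 10 := pow_le_pow_right₀ hX1 (by norm_num)
  -- a ≤ (20 + 2T) X²
  have ha : 2 * LgL + 4 * N ^ 2 + 2 * T + 12 ≤ (20 + 2 * T) * X ^ 2 := by
    have : 2 * T ≤ 2 * T * X ^ 2 := by nlinarith
    nlinarith
  have ha0 : 0 ≤ 2 * LgL + 4 * N ^ 2 + 2 * T + 12 := by positivity
  -- b ≤ (6T + 9) X³
  have hb : N ^ 2 * (1 + LgL) + 6 * T + 6 ≤ (6 * T + 9) * X ^ 3 := by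
    have h1 : N ^ 2 * (1 + LgL) ≤ X ^ 2 * (3 * X) :=
      mul_le_mul hN2 (by linarith) (by linarith) (by positivity)
    have h2 : 6 * T + 6 ≤ (6 * T + 6) * X ^ 3 := by nlinarith
    nlinarith
  have hb0 : 0 ≤ N ^ 2 * (1 + LgL) + 6 * T + 6 := by positivity
  -- e ≤ 8 X⁴
  have he : 33 / 10 * N ^ 2 * (N ^ 2 + 1) + 1 ≤ 8 * X ^ 4 := by
    have h1 : N ^ 2 * (N ^ 2 + 1) ≤ X ^ 2 * (X ^ 2 + X ^ 2) :=
      mul_le_mul hN2 (by linarith) (by positivity) (by positivity)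
    nlinarith
  have he0 : 0 ≤ 33 / 10 * N ^ 2 * (N ^ 2 + 1) + 1 := by positivity
  have hmain : 211 * N * (2 * LgL + 4 * N ^ 2 + 2 * T + 12) * (N ^ 2 * (1 + LgL) + 6 * T + 6) *
      (33 / 10 * N ^ 2 * (N ^ 2 + 1) + 1) ≤
      211 * X * ((20 + 2 * T) * X ^ 2) * ((6 * T + 9) * X ^ 3) * (8 * X ^ 4) := by
    refine mul_le_mul (mul_le_mul (mul_le_mul (mul_le_mul_of_nonneg_left hNX (by norm_num)) ha ha0
      (by positivity)) hb hb0 (by positivity)) he he0 (by positivity)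
  have hK0 : 0 ≤ 1688 * (20 + 2 * T) * (6 * T + 9) := by positivity
  have e1 : 211 * X * ((20 + 2 * T) * X ^ 2) * ((6 * T + 9) * X ^ 3) * (8 * X ^ 4) =
      1688 * (20 + 2 * T) * (6 * T + 9) * X ^ 10 := by ring
  rw [e1] at hmain
  have hbr : 211 * N * (2 * LgL + 4 * N ^ 2 + 2 * T + 12) * (N ^ 2 * (1 + LgL) + 6 * T + 6) *
        (33 / 10 * N ^ 2 * (N ^ 2 + 1) + 1) + 1 + Lg2 ≤
      (1688 * (20 + 2 * T) * (6 * T + 9) + 4) * X ^ 10 := by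
    nlinarith
  have hbr0 : 0 ≤ 211 * N * (2 * LgL + 4 * N ^ 2 + 2 * T + 12) * (N ^ 2 * (1 + LgL) + 6 * T + 6) *
        (33 / 10 * N ^ 2 * (N ^ 2 + 1) + 1) + 1 + Lg2 := by positivity
  calc N * ((211 * N * (2 * LgL + 4 * N ^ 2 + 2 * T + 12) * (N ^ 2 * (1 + LgL) + 6 * T + 6) *
        (33 / 10 * N ^ 2 * (N ^ 2 + 1) + 1) + 1) + Lg2)
      = N * (211 * N * (2 * LgL + 4 * N ^ 2 + 2 * T + 12) * (N ^ 2 * (1 + LgL) + 6 * T + 6) *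
        (33 / 10 * N ^ 2 * (N ^ 2 + 1) + 1) + 1 + Lg2) := by ring
    _ ≤ X * ((1688 * (20 + 2 * T) * (6 * T + 9) + 4) * X ^ 10) := mul_le_mul hNX hbr hbr0 hX0
    _ = (1688 * (20 + 2 * T) * (6 * T + 9) + 4) * X ^ 11 := by ring

/-- **Instance FIX.** A fixed point `t` of `exp` has finite transcendence type (`τ = 11`), mod NW96 Thm 1. -/
theorem finiteTranscendenceType_fixpoint (hNW : NesterenkoWaldschmidt1996_thm_1) {t : ℂ}
    (ht : cexp t = t) : FiniteTranscendenceType t := by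
  set T : ℝ := ‖t‖ with hT
  have hT0 : 0 ≤ T := norm_nonneg t
  refine ⟨1688 * (20 + 2 * T) * (6 * T + 9) + 4, 11, by positivity,
    fun S N H hS hN hdeg hH hcoef => ?_⟩
  have hlen := sum_abs_coeff_le hdeg hcoef
  have hL3 : 3 ≤ (N + 1) * H := by nlinarith
  have h := fix_measure hNW ht S hS hN hdeg hlen hL3
  refine le_trans (Real.exp_le_exp.mpr ?_) h
  rw [neg_le_neg_iff]
  have hN1 : (1 : ℝ) ≤ N := by exact_mod_cast hN
  have hN0 : (0 : ℝ) < N := by linarith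
  have hH16 : (16 : ℝ) ≤ H := by exact_mod_cast hH
  have hH0 : (0 : ℝ) < H := by linarith
  have hlogH0 : 0 ≤ Real.log H := Real.log_nonneg (by linarith)
  set X : ℝ := (N : ℝ) + Real.log H with hX
  have hX1 : 1 ≤ X := by linarith
  have hNX : (N : ℝ) ≤ X := by linarith
  have hl2 : Real.log 2 ≤ 1 := by linarith [Real.log_two_lt_d9]
  have hlogN : Real.log N ≤ N := log_le_self_of_pos hN0
  have hlogN1 : Real.log ((N : ℝ) + 1) ≤ N := by
    have := Real.log_le_sub_one_of_pos (by linarith : (0 : ℝ) < N + 1); linarith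
  have hL0 : (0 : ℝ) < ((N : ℝ) + 1) * H := by positivity
  have hlogL : Real.log (((N : ℝ) + 1) * H) ≤ X := by
    rw [Real.log_mul (by linarith) hH0.ne']; linarith
  have hlog2pos : 0 < Real.log 2 := Real.log_pos (by norm_num)
  have hlogN0 : 0 ≤ Real.log N := Real.log_nonneg hN1
  have hlogL0 : 0 ≤ Real.log (((N : ℝ) + 1) * H) := Real.log_nonneg (by nlinarith)
  have e1 : Real.log ((2 : ℝ) ^ N * (((N : ℝ) + 1) * H)) = N * Real.log 2 +
      Real.log (((N : ℝ) + 1) * H) := by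
    rw [Real.log_mul (by positivity) hL0.ne', Real.log_pow]
  have e2 : Real.log (2 * (N : ℝ) * (((N : ℝ) + 1) * H)) = Real.log 2 + Real.log N +
      Real.log (((N : ℝ) + 1) * H) := by
    rw [Real.log_mul (by positivity) hL0.ne', Real.log_mul (by norm_num) hN0.ne']
  have hLgL : Real.log ((2 : ℝ) ^ N * (((N : ℝ) + 1) * H)) ≤ 2 * X := by
    rw [e1]; have := mul_le_mul_of_nonneg_left hl2 hN0.le; linarith
  have hLgL0 : 0 ≤ Real.log ((2 : ℝ) ^ N * (((N : ℝ) + 1) * H)) := by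
    rw [e1]; positivity
  have hLg2 : Real.log (2 * (N : ℝ) * (((N : ℝ) + 1) * H)) ≤ 3 * X := by rw [e2]; linarith
  have hLg20 : 0 ≤ Real.log (2 * (N : ℝ) * (((N : ℝ) + 1) * H)) := by
    rw [e2]; positivity
  have hmain := fix_exponent_le hT0 hX1 hN0.le hNX hLgL0 hLgL hLg20 hLg2
  unfold fphi
  push_cast
  linarith [hmain]

end Fix

end Summit.Schanuel.Schanuel.Theorems.RootDecomp1KRadical
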